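import Literature.NumberTheory.EllipticCurves.TwoDescentLinearConditions
import Literature.NumberTheory.EllipticCurves.TwoDescentLocalTwoCN
import Literature.Barriers.BirchSwinnertonDyer.RankNotSumOfLocalInvariantsF4TwistPoints
import Mathlib.Tactic.NormNum.LegendreSymbol
import Mathlib.Tactic.NormNum.Prime
import HarnessLib

/-!
# Ranks of congruent number curves by complete `2`-descent over `ℚ` (III: `n = 1590`)

For the unconditional proof of conjunct (2) of
`Literature.Barriers.BirchSwinnertonDyer.DokchitserDokchitser2011_rankMod_notSumOfLocalInvariantsNarrow`
("`rk E(ℚ) mod 4` is not a sum of local invariants over the places of `ℚ`",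
`RankNotSumOfLocalInvariantsCNProofs.lean`) through Lemma 5 of T. Dokchitser–V. Dokchitser,
*A note on the Mordell–Weil rank modulo `n`*, J. Number Theory 131 (2011), applied to
`E₁ : y² = x³ - x` and `F = ℚ(√-6, √-15, √-159)` (`RankNotSumOfLocalInvariantsCNTwists.lean`), the
Mordell–Weil ranks over `ℚ` of the eight twists `E_n : y² = x³ - n²x`,
`n ∈ {1, 6, 10, 15, 106, 159, 265, 1590}`, are needed EXACTLY. This file proves `rk E_1590 = 1`
(`E<n>.mordellWeilRank_eq`), each by a complete `2`-descent over `ℚ` (Silverman, *AEC*,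
Prop. X.1.4) in the linear format of `TwoDescentLinearConditions.lean`:

* `ψ` = the sign and valuation-parity coordinates of `δ(P) = (x + n, x)` at the primes dividing
  `2n` (tree `signHom`, `parityHom`, through `charFst`/`charSnd`); `ψ` detects the descent class
  (`hker`, parity off `2n` by `Curve24A1.even_padicValRat_sub`);
* the local conditions: at `∞` (`signBit_sub_of_lt_of_lt`), at each odd `p ∣ n`
  (`local_condition_I0`, type `I₀*`, made linear by the square-free kernel
  `qrBit_eq_signBit_add_listSum` and the values of the Legendre symbols involved, `norm_num`), and
  for even `n` at `2` (`local_condition_two_cn`, `chi4_eq_signBit_add_listSum`) — assembled into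
  `κ ∘ ψ = 0` (`kill`) for an explicit surjective `κ : (ℤ/2)^N → (ℤ/2)^k` (`κ_surjective`), the
  finite implications being checked by `decide`; whence `rk ≤ N - k - 2`
  (`mordellWeilRank_le_of_linear_conditions`);
* explicit rational points, independent of the `2`-torsion under `ψ`
  (`le_mordellWeilRank_of_twoTorsion'`).

The coordinates, matrices, constants and points were found by a `2`-Selmer computation outside
Lean; every claim is re-verified by the kernel. No named facts.

## References

* J. H. Silverman, *The Arithmetic of Elliptic Curves*, 2nd ed., GTM 106 (2009), Prop. X.1.4
  (Complete 2-Descent) and Example X.1.5, pp. 270–272 of the held copy. [SilvermanAEC2009]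
* T. Dokchitser, V. Dokchitser, *A note on the Mordell–Weil rank modulo `n`*, J. Number Theory
  131 (2011) 1833–1839, arXiv:0910.4588, Lemma 5. [DokchitserDokchitser2011RankModN]
-/

noncomputable section

namespace Literature.Barriers.BirchSwinnertonDyer.CongruentDescent

open WeierstrassCurve WeierstrassCurve.Affine WeierstrassCurve.Affine.Point
open Literature.NumberTheory.EllipticCurves Literature.NumberTheory.EllipticCurves.KramerTwoDescent
open Literature.NumberTheory.EllipticCurves.TwoDescentLocal
open Literature.Barriers.BirchSwinnertonDyer.DokchitserDokchitser2011

/-- `5` is prime. [folklore] -/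
instance fact_prime_5C : Fact (Nat.Prime 5) := ⟨by norm_num⟩

/-- `53` is prime. [folklore] -/
instance fact_prime_53C : Fact (Nat.Prime 53) := ⟨by norm_num⟩

namespace E1590

/-! ### `E_1590`: rank `1` -/

/-- `E_1590 = congruentNumberCurve 1590`. [folklore] -/
abbrev E : WeierstrassCurve ℚ := congruentNumberCurve 1590

/-- `E_1590` is an elliptic curve. [folklore] -/
instance : (E).IsElliptic := isElliptic_congruentNumberCurve (by norm_num)

/-- Rational `2`-torsion `-1590, 0, 1590`. [folklore] -/
theorem hsplit : (E).toAffine.SplitTwoTorsion (-1590) 0 1590 := by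
  have h := splitTwoTorsion_cn 1590
  norm_num at h
  exact h

section Descent

/-- The sign/parity coordinates `(v_q(x+1590))_{q ∈ [2, 3, 5, 53]}, sign(x), (v_q(x))_{q ∈ [2, 3, 5, 53]}` of the `2`-descent. [folklore] -/
def ψ : (E).toAffine.Point →+ (Fin 9 → ZMod 2) :=
  AddMonoidHom.pi fun i => (![charFst hsplit (parityHom 2), charFst hsplit (parityHom 3), charFst hsplit (parityHom 5), charFst hsplit (parityHom 53), charSnd hsplit signHom, charSnd hsplit (parityHom 2), charSnd hsplit (parityHom 3), charSnd hsplit (parityHom 5), charSnd hsplit (parityHom 53)] : Fin 9 → ((E).toAffine.Point →+ ZMod 2)) i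

/-- `ψ` on an affine point off the `2`-torsion. [folklore] -/
theorem ψ_some {x y : ℚ} (hP : (E).toAffine.Nonsingular x y) (hx₁ : x ≠ -1590) (hx₂ : x ≠ 0) :
    ψ (.some x y hP) = ![parityBit 2 (x - -1590), parityBit 3 (x - -1590), parityBit 5 (x - -1590), parityBit 53 (x - -1590), signBit (x - 0), parityBit 2 (x - 0), parityBit 3 (x - 0), parityBit 5 (x - 0), parityBit 53 (x - 0)] := by
  have hx₁' : x - -1590 ≠ 0 := sub_ne_zero.mpr hx₁
  have hx₂' : x - 0 ≠ 0 := sub_ne_zero.mpr hx₂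
  ext i
  fin_cases i
  · show charFst hsplit (parityHom 2) (.some x y hP) = parityBit 2 (x - -1590)
    rw [charFst_apply, twoDescentComponent_some_of_ne hP hx₁, parityHom_sqClass hx₁']
  · show charFst hsplit (parityHom 3) (.some x y hP) = parityBit 3 (x - -1590)
    rw [charFst_apply, twoDescentComponent_some_of_ne hP hx₁, parityHom_sqClass hx₁']
  · show charFst hsplit (parityHom 5) (.some x y hP) = parityBit 5 (x - -1590)
    rw [charFst_apply, twoDescentComponent_some_of_ne hP hx₁, parityHom_sqClass hx₁']
  · show charFst hsplit (parityHom 53) (.some x y hP) = parityBit 53 (x - -1590)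
    rw [charFst_apply, twoDescentComponent_some_of_ne hP hx₁, parityHom_sqClass hx₁']
  · show charSnd hsplit signHom (.some x y hP) = signBit (x - 0)
    rw [charSnd_apply, twoDescentComponent_some_of_ne hP hx₂, signHom_sqClass hx₂']
  · show charSnd hsplit (parityHom 2) (.some x y hP) = parityBit 2 (x - 0)
    rw [charSnd_apply, twoDescentComponent_some_of_ne hP hx₂, parityHom_sqClass hx₂']
  · show charSnd hsplit (parityHom 3) (.some x y hP) = parityBit 3 (x - 0)
    rw [charSnd_apply, twoDescentComponent_some_of_ne hP hx₂, parityHom_sqClass hx₂']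
  · show charSnd hsplit (parityHom 5) (.some x y hP) = parityBit 5 (x - 0)
    rw [charSnd_apply, twoDescentComponent_some_of_ne hP hx₂, parityHom_sqClass hx₂']
  · show charSnd hsplit (parityHom 53) (.some x y hP) = parityBit 53 (x - 0)
    rw [charSnd_apply, twoDescentComponent_some_of_ne hP hx₂, parityHom_sqClass hx₂']

/-- `ψ(T₁)` for `T₁ = (-1590, 0)`. [folklore] -/
theorem ψ_T1 : ψ (.some _ _ (nonsingular_twoTorsion hsplit)) = ![1, 0, 0, 0, 1, 1, 1, 1, 1] := by
  have h₁ : (((-1590 : ℚ) - 0) * ((-1590 : ℚ) - 1590)) ≠ 0 := by norm_num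
  have h₂ : ((-1590 : ℚ) - 0) ≠ 0 := by norm_num
  ext i
  fin_cases i
  · show charFst hsplit (parityHom 2) _ = 1
    rw [charFst_apply, twoDescentComponent_some_of_eq _ rfl, parityHom_sqClass h₁]
    exact parityBit_eq_of_eq 2 3 (u := 632025) (v := 1) (1) (Or.inl rfl) (by norm_num) (by norm_num) (by norm_num)
  · show charFst hsplit (parityHom 3) _ = 0
    rw [charFst_apply, twoDescentComponent_some_of_eq _ rfl, parityHom_sqClass h₁]
    exact parityBit_eq_of_eq 3 2 (u := 561800) (v := 1) (1) (Or.inl rfl) (by norm_num) (by norm_num) (by norm_num)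
  · show charFst hsplit (parityHom 5) _ = 0
    rw [charFst_apply, twoDescentComponent_some_of_eq _ rfl, parityHom_sqClass h₁]
    exact parityBit_eq_of_eq 5 2 (u := 202248) (v := 1) (1) (Or.inl rfl) (by norm_num) (by norm_num) (by norm_num)
  · show charFst hsplit (parityHom 53) _ = 0
    rw [charFst_apply, twoDescentComponent_some_of_eq _ rfl, parityHom_sqClass h₁]
    exact parityBit_eq_of_eq 53 2 (u := 1800) (v := 1) (1) (Or.inl rfl) (by norm_num) (by norm_num) (by norm_num)
  · show charSnd hsplit signHom _ = 1
    rw [charSnd_apply, twoDescentComponent_some_of_ne _ (by norm_num), signHom_sqClass h₂]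
    exact signBit_of_neg (by norm_num)
  · show charSnd hsplit (parityHom 2) _ = 1
    rw [charSnd_apply, twoDescentComponent_some_of_ne _ (by norm_num), parityHom_sqClass h₂]
    exact parityBit_eq_of_eq 2 1 (u := 795) (v := 1) (-1) (Or.inr rfl) (by norm_num) (by norm_num) (by norm_num)
  · show charSnd hsplit (parityHom 3) _ = 1
    rw [charSnd_apply, twoDescentComponent_some_of_ne _ (by norm_num), parityHom_sqClass h₂]
    exact parityBit_eq_of_eq 3 1 (u := 530) (v := 1) (-1) (Or.inr rfl) (by norm_num) (by norm_num) (by norm_num)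
  · show charSnd hsplit (parityHom 5) _ = 1
    rw [charSnd_apply, twoDescentComponent_some_of_ne _ (by norm_num), parityHom_sqClass h₂]
    exact parityBit_eq_of_eq 5 1 (u := 318) (v := 1) (-1) (Or.inr rfl) (by norm_num) (by norm_num) (by norm_num)
  · show charSnd hsplit (parityHom 53) _ = 1
    rw [charSnd_apply, twoDescentComponent_some_of_ne _ (by norm_num), parityHom_sqClass h₂]
    exact parityBit_eq_of_eq 53 1 (u := 30) (v := 1) (-1) (Or.inr rfl) (by norm_num) (by norm_num) (by norm_num)

/-- `ψ(T₂)` for `T₂ = (0, 0)`. [folklore] -/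
theorem ψ_T2 : ψ (.some _ _ (nonsingular_twoTorsion hsplit.swap₁₂)) = ![1, 1, 1, 1, 1, 0, 0, 0, 0] := by
  have h₁ : ((0 : ℚ) - -1590) ≠ 0 := by norm_num
  have h₂ : (((0 : ℚ) - -1590) * ((0 : ℚ) - 1590)) ≠ 0 := by norm_num
  ext i
  fin_cases i
  · show charFst hsplit (parityHom 2) _ = 1
    rw [charFst_apply, twoDescentComponent_some_of_ne _ (by norm_num), parityHom_sqClass h₁]
    exact parityBit_eq_of_eq 2 1 (u := 795) (v := 1) (1) (Or.inl rfl) (by norm_num) (by norm_num) (by norm_num)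
  · show charFst hsplit (parityHom 3) _ = 1
    rw [charFst_apply, twoDescentComponent_some_of_ne _ (by norm_num), parityHom_sqClass h₁]
    exact parityBit_eq_of_eq 3 1 (u := 530) (v := 1) (1) (Or.inl rfl) (by norm_num) (by norm_num) (by norm_num)
  · show charFst hsplit (parityHom 5) _ = 1
    rw [charFst_apply, twoDescentComponent_some_of_ne _ (by norm_num), parityHom_sqClass h₁]
    exact parityBit_eq_of_eq 5 1 (u := 318) (v := 1) (1) (Or.inl rfl) (by norm_num) (by norm_num) (by norm_num)
  · show charFst hsplit (parityHom 53) _ = 1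
    rw [charFst_apply, twoDescentComponent_some_of_ne _ (by norm_num), parityHom_sqClass h₁]
    exact parityBit_eq_of_eq 53 1 (u := 30) (v := 1) (1) (Or.inl rfl) (by norm_num) (by norm_num) (by norm_num)
  · show charSnd hsplit signHom _ = 1
    rw [charSnd_apply, twoDescentComponent_some_of_eq _ rfl, signHom_sqClass h₂]
    exact signBit_of_neg (by norm_num)
  · show charSnd hsplit (parityHom 2) _ = 0
    rw [charSnd_apply, twoDescentComponent_some_of_eq _ rfl, parityHom_sqClass h₂]
    exact parityBit_eq_of_eq 2 2 (u := 632025) (v := 1) (-1) (Or.inr rfl) (by norm_num) (by norm_num) (by norm_num)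
  · show charSnd hsplit (parityHom 3) _ = 0
    rw [charSnd_apply, twoDescentComponent_some_of_eq _ rfl, parityHom_sqClass h₂]
    exact parityBit_eq_of_eq 3 2 (u := 280900) (v := 1) (-1) (Or.inr rfl) (by norm_num) (by norm_num) (by norm_num)
  · show charSnd hsplit (parityHom 5) _ = 0
    rw [charSnd_apply, twoDescentComponent_some_of_eq _ rfl, parityHom_sqClass h₂]
    exact parityBit_eq_of_eq 5 2 (u := 101124) (v := 1) (-1) (Or.inr rfl) (by norm_num) (by norm_num) (by norm_num)
  · show charSnd hsplit (parityHom 53) _ = 0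
    rw [charSnd_apply, twoDescentComponent_some_of_eq _ rfl, parityHom_sqClass h₂]
    exact parityBit_eq_of_eq 53 2 (u := 900) (v := 1) (-1) (Or.inr rfl) (by norm_num) (by norm_num) (by norm_num)

/-- `ψ(T₃)` for `T₃ = (1590, 0)`. [folklore] -/
theorem ψ_T3 : ψ (.some _ _ (nonsingular_twoTorsion hsplit.swap₂₃.swap₁₂)) = ![0, 1, 1, 1, 0, 1, 1, 1, 1] := by
  have h₁ : ((1590 : ℚ) - -1590) ≠ 0 := by norm_num
  have h₂ : ((1590 : ℚ) - 0) ≠ 0 := by norm_num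
  ext i
  fin_cases i
  · show charFst hsplit (parityHom 2) _ = 0
    rw [charFst_apply, twoDescentComponent_some_of_ne _ (by norm_num), parityHom_sqClass h₁]
    exact parityBit_eq_of_eq 2 2 (u := 795) (v := 1) (1) (Or.inl rfl) (by norm_num) (by norm_num) (by norm_num)
  · show charFst hsplit (parityHom 3) _ = 1
    rw [charFst_apply, twoDescentComponent_some_of_ne _ (by norm_num), parityHom_sqClass h₁]
    exact parityBit_eq_of_eq 3 1 (u := 1060) (v := 1) (1) (Or.inl rfl) (by norm_num) (by norm_num) (by norm_num)
  · show charFst hsplit (parityHom 5) _ = 1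
    rw [charFst_apply, twoDescentComponent_some_of_ne _ (by norm_num), parityHom_sqClass h₁]
    exact parityBit_eq_of_eq 5 1 (u := 636) (v := 1) (1) (Or.inl rfl) (by norm_num) (by norm_num) (by norm_num)
  · show charFst hsplit (parityHom 53) _ = 1
    rw [charFst_apply, twoDescentComponent_some_of_ne _ (by norm_num), parityHom_sqClass h₁]
    exact parityBit_eq_of_eq 53 1 (u := 60) (v := 1) (1) (Or.inl rfl) (by norm_num) (by norm_num) (by norm_num)
  · show charSnd hsplit signHom _ = 0
    rw [charSnd_apply, twoDescentComponent_some_of_ne _ (by norm_num), signHom_sqClass h₂]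
    exact signBit_of_nonneg (by norm_num)
  · show charSnd hsplit (parityHom 2) _ = 1
    rw [charSnd_apply, twoDescentComponent_some_of_ne _ (by norm_num), parityHom_sqClass h₂]
    exact parityBit_eq_of_eq 2 1 (u := 795) (v := 1) (1) (Or.inl rfl) (by norm_num) (by norm_num) (by norm_num)
  · show charSnd hsplit (parityHom 3) _ = 1
    rw [charSnd_apply, twoDescentComponent_some_of_ne _ (by norm_num), parityHom_sqClass h₂]
    exact parityBit_eq_of_eq 3 1 (u := 530) (v := 1) (1) (Or.inl rfl) (by norm_num) (by norm_num) (by norm_num)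
  · show charSnd hsplit (parityHom 5) _ = 1
    rw [charSnd_apply, twoDescentComponent_some_of_ne _ (by norm_num), parityHom_sqClass h₂]
    exact parityBit_eq_of_eq 5 1 (u := 318) (v := 1) (1) (Or.inl rfl) (by norm_num) (by norm_num) (by norm_num)
  · show charSnd hsplit (parityHom 53) _ = 1
    rw [charSnd_apply, twoDescentComponent_some_of_ne _ (by norm_num), parityHom_sqClass h₂]
    exact parityBit_eq_of_eq 53 1 (u := 30) (v := 1) (1) (Or.inl rfl) (by norm_num) (by norm_num) (by norm_num)

/-- The matrix of the 6 independent linear local conditions. [folklore] -/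
def M : Matrix (Fin 6) (Fin 9) (ZMod 2) :=
  !![1, 1, 1, 1, 0, 0, 1, 0, 0; 0, 1, 0, 0, 1, 1, 0, 1, 1; 1, 1, 1, 1, 0, 0, 0, 1, 0; 0, 0, 0, 0, 0, 1, 1, 1, 1; 1, 1, 1, 1, 0, 0, 0, 0, 1; 1, 0, 0, 0, 1, 1, 1, 0, 0]

/-- `κ = M ·` as an additive map. [folklore] -/
def κ : (Fin 9 → ZMod 2) →+ (Fin 6 → ZMod 2) := (Matrix.mulVecLin M).toAddMonoidHom

set_option synthInstance.maxSize 100000 in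
set_option synthInstance.maxHeartbeats 400000 in
/-- `κ` is onto (explicit preimages of the basis vectors). [folklore] -/
theorem κ_surjective : Function.Surjective κ := by
  intro w
  refine ⟨![0, 0, 0, w 0 + w 1 + w 2 + w 4 + w 5, w 2 + w 3 + w 4 + w 5, w 1 + w 3 + w 5, w 1 + w 2 + w 4 + w 5, w 0 + w 1 + w 4 + w 5, w 0 + w 1 + w 2 + w 5], ?_⟩
  revert w
  decide

set_option synthInstance.maxSize 100000 in
set_option synthInstance.maxHeartbeats 400000 in
/-- `κ` vanishes on vectors satisfying the 6 conditions. [folklore] -/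
theorem κ_eq_zero_of_rows (a2 a3 a5 a53 s2 b2 b3 b5 b53 : ZMod 2)
    (r0 : a2 + a3 + a5 + a53 + b3 = 0)
    (r1 : a3 + s2 + b2 + b5 + b53 = 0)
    (r2 : a2 + a3 + a5 + a53 + b5 = 0)
    (r3 : b2 + b3 + b5 + b53 = 0)
    (r4 : a2 + a3 + a5 + a53 + b53 = 0)
    (r5 : a2 + s2 + b2 + b3 = 0)
    : κ ![a2, a3, a5, a53, s2, b2, b3, b5, b53] = 0 := by
  revert r0 r1 r2 r3 r4 r5 a2 a3 a5 a53 s2 b2 b3 b5 b53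
  decide

set_option synthInstance.maxSize 100000 in
set_option synthInstance.maxHeartbeats 400000 in
/-- The local conditions at `p = 3` in coordinates (abstract form, by enumeration). [folklore] -/
theorem rows_3 (a2 a3 a5 a53 s2 b2 b3 b5 b53 : ZMod 2)
    (H : (a3 = 0 ∧ (a2 * 1 + (a5 * 1 + (a53 * 1 + 0))) = 0 ∧ b3 = 0 ∧ s2 * 1 + (b2 * 1 + (b5 * 1 + (b53 * 1 + 0))) = 0) ∨ (a3 = 0 ∧ (a2 * 1 + (a5 * 1 + (a53 * 1 + 0))) = 1 ∧ b3 = 1 ∧ s2 * 1 + (b2 * 1 + (b5 * 1 + (b53 * 1 + 0))) = 0) ∨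
      (a3 = 1 ∧ (a2 * 1 + (a5 * 1 + (a53 * 1 + 0))) = 1 ∧ b3 = 0 ∧ s2 * 1 + (b2 * 1 + (b5 * 1 + (b53 * 1 + 0))) = 1) ∨ (a3 = 1 ∧ (a2 * 1 + (a5 * 1 + (a53 * 1 + 0))) = 0 ∧ b3 = 1 ∧ s2 * 1 + (b2 * 1 + (b5 * 1 + (b53 * 1 + 0))) = 1)) :
    (a2 + a3 + a5 + a53 + b3 = 0) ∧ (a3 + s2 + b2 + b5 + b53 = 0) := by
  revert H a2 a3 a5 a53 s2 b2 b3 b5 b53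
  decide

set_option synthInstance.maxSize 100000 in
set_option synthInstance.maxHeartbeats 400000 in
/-- The local conditions at `p = 5` in coordinates (abstract form, by enumeration). [folklore] -/
theorem rows_5 (a2 a3 a5 a53 s2 b2 b3 b5 b53 : ZMod 2)
    (H : (a5 = 0 ∧ (a2 * 1 + (a3 * 1 + (a53 * 1 + 0))) = 0 ∧ b5 = 0 ∧ s2 * 0 + (b2 * 1 + (b3 * 1 + (b53 * 1 + 0))) = 0) ∨ (a5 = 0 ∧ (a2 * 1 + (a3 * 1 + (a53 * 1 + 0))) = 1 ∧ b5 = 1 ∧ s2 * 0 + (b2 * 1 + (b3 * 1 + (b53 * 1 + 0))) = 1) ∨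
      (a5 = 1 ∧ (a2 * 1 + (a3 * 1 + (a53 * 1 + 0))) = 1 ∧ b5 = 0 ∧ s2 * 0 + (b2 * 1 + (b3 * 1 + (b53 * 1 + 0))) = 0) ∨ (a5 = 1 ∧ (a2 * 1 + (a3 * 1 + (a53 * 1 + 0))) = 0 ∧ b5 = 1 ∧ s2 * 0 + (b2 * 1 + (b3 * 1 + (b53 * 1 + 0))) = 1)) :
    (a2 + a3 + a5 + a53 + b5 = 0) ∧ (b2 + b3 + b5 + b53 = 0) := by
  revert H a2 a3 a5 a53 s2 b2 b3 b5 b53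
  decide

set_option synthInstance.maxSize 100000 in
set_option synthInstance.maxHeartbeats 400000 in
/-- The local conditions at `p = 53` in coordinates (abstract form, by enumeration). [folklore] -/
theorem rows_53 (a2 a3 a5 a53 s2 b2 b3 b5 b53 : ZMod 2)
    (H : (a53 = 0 ∧ (a2 * 1 + (a3 * 1 + (a5 * 1 + 0))) = 0 ∧ b53 = 0 ∧ s2 * 0 + (b2 * 1 + (b3 * 1 + (b5 * 1 + 0))) = 0) ∨ (a53 = 0 ∧ (a2 * 1 + (a3 * 1 + (a5 * 1 + 0))) = 1 ∧ b53 = 1 ∧ s2 * 0 + (b2 * 1 + (b3 * 1 + (b5 * 1 + 0))) = 1) ∨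
      (a53 = 1 ∧ (a2 * 1 + (a3 * 1 + (a5 * 1 + 0))) = 1 ∧ b53 = 0 ∧ s2 * 0 + (b2 * 1 + (b3 * 1 + (b5 * 1 + 0))) = 0) ∨ (a53 = 1 ∧ (a2 * 1 + (a3 * 1 + (a5 * 1 + 0))) = 0 ∧ b53 = 1 ∧ s2 * 0 + (b2 * 1 + (b3 * 1 + (b5 * 1 + 0))) = 1)) :
    (a2 + a3 + a5 + a53 + b53 = 0) := by
  revert H a2 a3 a5 a53 s2 b2 b3 b5 b53
  decide

set_option synthInstance.maxSize 100000 in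
set_option synthInstance.maxHeartbeats 400000 in
/-- The `2`-adic condition in coordinates (abstract form, by enumeration). [folklore] -/
theorem rows_2 (a2 a3 a5 a53 s2 b2 b3 b5 b53 : ZMod 2)
    (H : a2 = s2 * 1 + (b3 * 1 + (b5 * 0 + (b53 * 0 + 0))) + 1 * b2) :
    a2 + s2 + b2 + b3 = 0 := by
  revert H a2 a3 a5 a53 s2 b2 b3 b5 b53
  decide

/-- **The local conditions hold on `E_1590(ℚ)`**: `κ ∘ ψ = 0`. [cite: SilvermanAEC2009, Prop. X.1.4] -/
theorem kill (P : (E).toAffine.Point) : κ (ψ P) = 0 := by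
  rcases point_cases hsplit P with rfl | rfl | rfl | rfl |
      ⟨x, y, hP, rfl, hx₁, hx₂, hx₃, hy, hsq⟩
  · rw [_root_.map_zero, _root_.map_zero]
  · rw [ψ_T1]; decide
  · rw [ψ_T2]; decide
  · rw [ψ_T3]; decide
  · simp only [cn_affine_a₁, cn_affine_a₃, zero_mul, add_zero, zero_div] at hy hsq
    rw [ψ_some hP hx₁ hx₂]
    obtain ⟨hd₁, hd₂, hd₃⟩ := sub_ne_zero_of_sq_eq hsq hy
    have hsgn := signBit_sub_of_lt_of_lt hsq hy (by norm_num) (by norm_num)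
    have hev₁ : ∀ q : ℕ, q.Prime → q ∉ ([2, 3, 5, 53] : List ℕ) → Even (padicValRat q (x - -1590)) := by
      intro q hq hql
      haveI : Fact q.Prime := ⟨hq⟩
      refine Curve24A1.even_padicValRat_sub q (by norm_num) (by norm_num) ?_ ?_ hy hsq
      · rw [show (-1590 : ℚ) - 0 = ((-1590 : ℤ) : ℚ) by norm_num]
        exact padicValRat_eq_zero_of_eq_prod hq [2, 3, 5, 53] (by norm_num) (fun h => hql (by simp at h ⊢; omega)) (by norm_num)
      · rw [show (-1590 : ℚ) - 1590 = ((-3180 : ℤ) : ℚ) by norm_num]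
        exact padicValRat_eq_zero_of_eq_prod hq [2, 2, 3, 5, 53] (by norm_num) (fun h => hql (by simp at h ⊢; omega)) (by norm_num)
    have hev₂ : ∀ q : ℕ, q.Prime → q ∉ ([2, 3, 5, 53] : List ℕ) → Even (padicValRat q (x - 0)) := by
      intro q hq hql
      haveI : Fact q.Prime := ⟨hq⟩
      refine Curve24A1.even_padicValRat_sub q (by norm_num) (by norm_num) ?_ ?_ hy
        (show y ^ 2 = (x - 0) * (x - -1590) * (x - 1590) by rw [hsq]; ring)
      · rw [show (0 : ℚ) - -1590 = ((1590 : ℤ) : ℚ) by norm_num]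
        exact padicValRat_eq_zero_of_eq_prod hq [2, 3, 5, 53] (by norm_num) (fun h => hql (by simp at h ⊢; omega)) (by norm_num)
      · rw [show (0 : ℚ) - 1590 = ((-1590 : ℤ) : ℚ) by norm_num]
        exact padicValRat_eq_zero_of_eq_prod hq [2, 3, 5, 53] (by norm_num) (fun h => hql (by simp at h ⊢; omega)) (by norm_num)
    -- p = 3
    have H3 := local_condition_I0 (p := 3) hsq hy
      (padicValRat_eq_of_eq (p := 3) 1 (u := 530) (v := 1) (-1) (Or.inr rfl) (by norm_num) (by norm_num) (by norm_num))
      (padicValRat_eq_of_eq (p := 3) 1 (u := 1060) (v := 1) (-1) (Or.inr rfl) (by norm_num) (by norm_num) (by norm_num))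
      (padicValRat_eq_of_eq (p := 3) 1 (u := 530) (v := 1) (-1) (Or.inr rfl) (by norm_num) (by norm_num) (by norm_num))
    have B3₁ := qrBit_eq_signBit_add_listSum (p := 3) hd₁ [2, 5, 53] (by decide) (by norm_num) (by decide)
      (fun q hq hql hqp => hev₁ q hq (by simp at hql ⊢; omega))
    have B3₂ := qrBit_eq_signBit_add_listSum (p := 3) hd₂ [2, 5, 53] (by decide) (by norm_num) (by decide)
      (fun q hq hql hqp => hev₂ q hq (by simp at hql ⊢; omega))
    simp only [List.map_cons, List.map_nil, List.sum_cons, List.sum_nil] at B3₁ B3₂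
    have c3_0 : qrBit 3 (((-1590 : ℚ) - 0) * (-1590 - 1590)) = 1 := qrBit_eq_one_of_eq (p := 3) 2 (561800) (by norm_num) (by norm_num)
    have c3_1 : qrBit 3 ((-1590 : ℚ) - 0) = 0 := qrBit_eq_zero_of_eq (p := 3) 1 (-530) (by norm_num) (by norm_num)
    have c3_2 : qrBit 3 ((0 : ℚ) - -1590) = 1 := qrBit_eq_one_of_eq (p := 3) 1 (530) (by norm_num) (by norm_num)
    have c3_3 : qrBit 3 (((0 : ℚ) - -1590) * (0 - 1590)) = 1 := qrBit_eq_one_of_eq (p := 3) 2 (-280900) (by norm_num) (by norm_num)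
    have c3_4 : qrBit 3 ((1590 : ℚ) - -1590) = 0 := qrBit_eq_zero_of_eq (p := 3) 1 (1060) (by norm_num) (by norm_num)
    have c3_5 : qrBit 3 ((1590 : ℚ) - 0) = 1 := qrBit_eq_one_of_eq (p := 3) 1 (530) (by norm_num) (by norm_num)
    have c3_6 : qrBit 3 ((-1 : ℚ)) = 1 := qrBit_eq_one_of_eq (p := 3) 0 (-1) (by norm_num) (by norm_num)
    have c3_7 : qrBit 3 (((2 : ℕ) : ℚ)) = 1 := qrBit_eq_one_of_eq (p := 3) 0 (2) (by norm_num) (by norm_num)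
    have c3_8 : qrBit 3 (((5 : ℕ) : ℚ)) = 1 := qrBit_eq_one_of_eq (p := 3) 0 (5) (by norm_num) (by norm_num)
    have c3_9 : qrBit 3 (((53 : ℕ) : ℚ)) = 1 := qrBit_eq_one_of_eq (p := 3) 0 (53) (by norm_num) (by norm_num)
    rw [c3_0, c3_1, c3_2, c3_3, c3_4, c3_5] at H3
    rw [hsgn.1, zero_mul, zero_add, c3_7, c3_8, c3_9] at B3₁
    rw [c3_6, c3_7, c3_8, c3_9] at B3₂
    rw [B3₁, B3₂] at H3
    have R3 := rows_3 (parityBit 2 (x - -1590)) (parityBit 3 (x - -1590)) (parityBit 5 (x - -1590)) (parityBit 53 (x - -1590)) (signBit (x - 0)) (parityBit 2 (x - 0)) (parityBit 3 (x - 0)) (parityBit 5 (x - 0)) (parityBit 53 (x - 0)) H3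
    -- p = 5
    have H5 := local_condition_I0 (p := 5) hsq hy
      (padicValRat_eq_of_eq (p := 5) 1 (u := 318) (v := 1) (-1) (Or.inr rfl) (by norm_num) (by norm_num) (by norm_num))
      (padicValRat_eq_of_eq (p := 5) 1 (u := 636) (v := 1) (-1) (Or.inr rfl) (by norm_num) (by norm_num) (by norm_num))
      (padicValRat_eq_of_eq (p := 5) 1 (u := 318) (v := 1) (-1) (Or.inr rfl) (by norm_num) (by norm_num) (by norm_num))
    have B5₁ := qrBit_eq_signBit_add_listSum (p := 5) hd₁ [2, 3, 53] (by decide) (by norm_num) (by decide)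
      (fun q hq hql hqp => hev₁ q hq (by simp at hql ⊢; omega))
    have B5₂ := qrBit_eq_signBit_add_listSum (p := 5) hd₂ [2, 3, 53] (by decide) (by norm_num) (by decide)
      (fun q hq hql hqp => hev₂ q hq (by simp at hql ⊢; omega))
    simp only [List.map_cons, List.map_nil, List.sum_cons, List.sum_nil] at B5₁ B5₂
    have c5_0 : qrBit 5 (((-1590 : ℚ) - 0) * (-1590 - 1590)) = 1 := qrBit_eq_one_of_eq (p := 5) 2 (202248) (by norm_num) (by norm_num)
    have c5_1 : qrBit 5 ((-1590 : ℚ) - 0) = 1 := qrBit_eq_one_of_eq (p := 5) 1 (-318) (by norm_num) (by norm_num)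
    have c5_2 : qrBit 5 ((0 : ℚ) - -1590) = 1 := qrBit_eq_one_of_eq (p := 5) 1 (318) (by norm_num) (by norm_num)
    have c5_3 : qrBit 5 (((0 : ℚ) - -1590) * (0 - 1590)) = 0 := qrBit_eq_zero_of_eq (p := 5) 2 (-101124) (by norm_num) (by norm_num)
    have c5_4 : qrBit 5 ((1590 : ℚ) - -1590) = 0 := qrBit_eq_zero_of_eq (p := 5) 1 (636) (by norm_num) (by norm_num)
    have c5_5 : qrBit 5 ((1590 : ℚ) - 0) = 1 := qrBit_eq_one_of_eq (p := 5) 1 (318) (by norm_num) (by norm_num)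
    have c5_6 : qrBit 5 ((-1 : ℚ)) = 0 := qrBit_eq_zero_of_eq (p := 5) 0 (-1) (by norm_num) (by norm_num)
    have c5_7 : qrBit 5 (((2 : ℕ) : ℚ)) = 1 := qrBit_eq_one_of_eq (p := 5) 0 (2) (by norm_num) (by norm_num)
    have c5_8 : qrBit 5 (((3 : ℕ) : ℚ)) = 1 := qrBit_eq_one_of_eq (p := 5) 0 (3) (by norm_num) (by norm_num)
    have c5_9 : qrBit 5 (((53 : ℕ) : ℚ)) = 1 := qrBit_eq_one_of_eq (p := 5) 0 (53) (by norm_num) (by norm_num)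
    rw [c5_0, c5_1, c5_2, c5_3, c5_4, c5_5] at H5
    rw [hsgn.1, zero_mul, zero_add, c5_7, c5_8, c5_9] at B5₁
    rw [c5_6, c5_7, c5_8, c5_9] at B5₂
    rw [B5₁, B5₂] at H5
    have R5 := rows_5 (parityBit 2 (x - -1590)) (parityBit 3 (x - -1590)) (parityBit 5 (x - -1590)) (parityBit 53 (x - -1590)) (signBit (x - 0)) (parityBit 2 (x - 0)) (parityBit 3 (x - 0)) (parityBit 5 (x - 0)) (parityBit 53 (x - 0)) H5
    -- p = 53
    have H53 := local_condition_I0 (p := 53) hsq hy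
      (padicValRat_eq_of_eq (p := 53) 1 (u := 30) (v := 1) (-1) (Or.inr rfl) (by norm_num) (by norm_num) (by norm_num))
      (padicValRat_eq_of_eq (p := 53) 1 (u := 60) (v := 1) (-1) (Or.inr rfl) (by norm_num) (by norm_num) (by norm_num))
      (padicValRat_eq_of_eq (p := 53) 1 (u := 30) (v := 1) (-1) (Or.inr rfl) (by norm_num) (by norm_num) (by norm_num))
    have B53₁ := qrBit_eq_signBit_add_listSum (p := 53) hd₁ [2, 3, 5] (by decide) (by norm_num) (by decide)
      (fun q hq hql hqp => hev₁ q hq (by simp at hql ⊢; omega))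
    have B53₂ := qrBit_eq_signBit_add_listSum (p := 53) hd₂ [2, 3, 5] (by decide) (by norm_num) (by decide)
      (fun q hq hql hqp => hev₂ q hq (by simp at hql ⊢; omega))
    simp only [List.map_cons, List.map_nil, List.sum_cons, List.sum_nil] at B53₁ B53₂
    have c53_0 : qrBit 53 (((-1590 : ℚ) - 0) * (-1590 - 1590)) = 1 := qrBit_eq_one_of_eq (p := 53) 2 (1800) (by norm_num) (by norm_num)
    have c53_1 : qrBit 53 ((-1590 : ℚ) - 0) = 1 := qrBit_eq_one_of_eq (p := 53) 1 (-30) (by norm_num) (by norm_num)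
    have c53_2 : qrBit 53 ((0 : ℚ) - -1590) = 1 := qrBit_eq_one_of_eq (p := 53) 1 (30) (by norm_num) (by norm_num)
    have c53_3 : qrBit 53 (((0 : ℚ) - -1590) * (0 - 1590)) = 0 := qrBit_eq_zero_of_eq (p := 53) 2 (-900) (by norm_num) (by norm_num)
    have c53_4 : qrBit 53 ((1590 : ℚ) - -1590) = 0 := qrBit_eq_zero_of_eq (p := 53) 1 (60) (by norm_num) (by norm_num)
    have c53_5 : qrBit 53 ((1590 : ℚ) - 0) = 1 := qrBit_eq_one_of_eq (p := 53) 1 (30) (by norm_num) (by norm_num)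
    have c53_6 : qrBit 53 ((-1 : ℚ)) = 0 := qrBit_eq_zero_of_eq (p := 53) 0 (-1) (by norm_num) (by norm_num)
    have c53_7 : qrBit 53 (((2 : ℕ) : ℚ)) = 1 := qrBit_eq_one_of_eq (p := 53) 0 (2) (by norm_num) (by norm_num)
    have c53_8 : qrBit 53 (((3 : ℕ) : ℚ)) = 1 := qrBit_eq_one_of_eq (p := 53) 0 (3) (by norm_num) (by norm_num)
    have c53_9 : qrBit 53 (((5 : ℕ) : ℚ)) = 1 := qrBit_eq_one_of_eq (p := 53) 0 (5) (by norm_num) (by norm_num)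
    rw [c53_0, c53_1, c53_2, c53_3, c53_4, c53_5] at H53
    rw [hsgn.1, zero_mul, zero_add, c53_7, c53_8, c53_9] at B53₁
    rw [c53_6, c53_7, c53_8, c53_9] at B53₂
    rw [B53₁, B53₂] at H53
    have R53 := rows_53 (parityBit 2 (x - -1590)) (parityBit 3 (x - -1590)) (parityBit 5 (x - -1590)) (parityBit 53 (x - -1590)) (signBit (x - 0)) (parityBit 2 (x - 0)) (parityBit 3 (x - 0)) (parityBit 5 (x - 0)) (parityBit 53 (x - 0)) H53
    -- p = 2
    have H2 := local_condition_two_cn (m := 795) ⟨397, by norm_num⟩ (n := 1590) (by norm_num) hsq hy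
    have C2 := chi4_eq_signBit_add_listSum hd₂ [3, 5, 53] (by decide) (by norm_num) (by decide)
      (fun q hq hql hq2 => hev₂ q hq (by simp at hql ⊢; omega))
    simp only [List.map_cons, List.map_nil, List.sum_cons, List.sum_nil] at C2
    have k2_0 : chi4 (-1 : ℚ) = 1 := chi4_neg_one
    have k2_1 : chi4 (((3 : ℕ) : ℚ)) = 1 := chi4_eq_one_of_eq 0 (3) (by norm_num) (by norm_num)
    have k2_2 : chi4 (((5 : ℕ) : ℚ)) = 0 := chi4_eq_zero_of_eq 0 (5) (by norm_num) (by norm_num)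
    have k2_3 : chi4 (((53 : ℕ) : ℚ)) = 0 := chi4_eq_zero_of_eq 0 (53) (by norm_num) (by norm_num)
    have k2_m : chi4 (((795 : ℤ) : ℚ)) = 1 := chi4_eq_one_of_eq 0 (795) (by norm_num) (by norm_num)
    rw [k2_0, k2_1, k2_2, k2_3] at C2
    rw [C2, k2_m] at H2
    have R2 := rows_2 (parityBit 2 (x - -1590)) (parityBit 3 (x - -1590)) (parityBit 5 (x - -1590)) (parityBit 53 (x - -1590)) (signBit (x - 0)) (parityBit 2 (x - 0)) (parityBit 3 (x - 0)) (parityBit 5 (x - 0)) (parityBit 53 (x - 0)) H2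
    exact κ_eq_zero_of_rows _ _ _ _ _ _ _ _ _ R3.1 R3.2 R5.1 R5.2 R53 R2

/-- `ψ` detects the `2`-descent class: `ψ P = 0 ⟹ δ(P) = 0`. [cite: SilvermanAEC2009, Prop. X.1.4] -/
theorem hker (P : (E).toAffine.Point) (h0 : ψ P = 0) : twoDescentMap hsplit P = 0 := by
  have hc : ∀ i, ψ P i = 0 := fun i => by rw [h0]; rfl
  rw [twoDescentMap_apply, ofMul_eq_zero, Prod.mk_eq_one]
  constructor
  · refine twoDescentComponent_eq_one hsplit P ([2, 3, 5, 53] : List ℕ).toFinset ?_ (descentRep_pos hsplit (by norm_num) (by norm_num) P) ?_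
    · intro q hq hqT
      rw [List.mem_toFinset] at hqT
      constructor
      · rw [show (-1590 : ℚ) - 0 = ((-1590 : ℤ) : ℚ) by norm_num]
        exact padicValRat_eq_zero_of_eq_prod hq [2, 3, 5, 53] (by norm_num) (fun h => hqT (by simp at h ⊢; omega)) (by norm_num)
      · rw [show (-1590 : ℚ) - 1590 = ((-3180 : ℤ) : ℚ) by norm_num]
        exact padicValRat_eq_zero_of_eq_prod hq [2, 2, 3, 5, 53] (by norm_num) (fun h => hqT (by simp at h ⊢; omega)) (by norm_num)
    · intro q hq
      have hrep := twoDescentComponent_eq_sqClass (W := (E).toAffine) (e₁ := -1590) (e₂ := 0) (e₃ := 1590) P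
      have hne := descentRep_ne_zero hsplit P
      simp only [List.toFinset_cons, List.toFinset_nil, Finset.mem_insert, Finset.notMem_empty, or_false] at hq
      rcases hq with rfl | rfl | rfl | rfl
      · have h : charFst hsplit (parityHom 2) P = 0 := hc 0
        rw [charFst_apply, hrep, parityHom_sqClass hne] at h
        exact parityBit_eq_zero_iff.mp h
      · have h : charFst hsplit (parityHom 3) P = 0 := hc 1
        rw [charFst_apply, hrep, parityHom_sqClass hne] at h
        exact parityBit_eq_zero_iff.mp h
      · have h : charFst hsplit (parityHom 5) P = 0 := hc 2
        rw [charFst_apply, hrep, parityHom_sqClass hne] at h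
        exact parityBit_eq_zero_iff.mp h
      · have h : charFst hsplit (parityHom 53) P = 0 := hc 3
        rw [charFst_apply, hrep, parityHom_sqClass hne] at h
        exact parityBit_eq_zero_iff.mp h
  · have hrep := twoDescentComponent_eq_sqClass (W := (E).toAffine) (e₁ := 0) (e₂ := -1590) (e₃ := 1590) P
    have hne := descentRep_ne_zero hsplit.swap₁₂ P
    have hs : charSnd hsplit signHom P = 0 := hc 4
    rw [charSnd_apply, hrep, signHom_sqClass hne] at hs
    refine twoDescentComponent_eq_one hsplit.swap₁₂ P ([2, 3, 5, 53] : List ℕ).toFinset ?_ (descentRep_pos_of_signBit hsplit.swap₁₂ P hs) ?_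
    · intro q hq hqT
      rw [List.mem_toFinset] at hqT
      constructor
      · rw [show (0 : ℚ) - -1590 = ((1590 : ℤ) : ℚ) by norm_num]
        exact padicValRat_eq_zero_of_eq_prod hq [2, 3, 5, 53] (by norm_num) (fun h => hqT (by simp at h ⊢; omega)) (by norm_num)
      · rw [show (0 : ℚ) - 1590 = ((-1590 : ℤ) : ℚ) by norm_num]
        exact padicValRat_eq_zero_of_eq_prod hq [2, 3, 5, 53] (by norm_num) (fun h => hqT (by simp at h ⊢; omega)) (by norm_num)
    · intro q hq
      simp only [List.toFinset_cons, List.toFinset_nil, Finset.mem_insert, Finset.notMem_empty, or_false] at hq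
      rcases hq with rfl | rfl | rfl | rfl
      · have h : charSnd hsplit (parityHom 2) P = 0 := hc 5
        rw [charSnd_apply, hrep, parityHom_sqClass hne] at h
        exact parityBit_eq_zero_iff.mp h
      · have h : charSnd hsplit (parityHom 3) P = 0 := hc 6
        rw [charSnd_apply, hrep, parityHom_sqClass hne] at h
        exact parityBit_eq_zero_iff.mp h
      · have h : charSnd hsplit (parityHom 5) P = 0 := hc 7
        rw [charSnd_apply, hrep, parityHom_sqClass hne] at h
        exact parityBit_eq_zero_iff.mp h
      · have h : charSnd hsplit (parityHom 53) P = 0 := hc 8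
        rw [charSnd_apply, hrep, parityHom_sqClass hne] at h
        exact parityBit_eq_zero_iff.mp h

end Descent

/-- **`rk E_1590(ℚ) ≤ 1`** by the complete `2`-descent: the `8` values of `ψ` allowed by the local conditions bound `#E(ℚ)/2E(ℚ) = 2^{r+2}`. [cite: SilvermanAEC2009, Prop. X.1.4] -/
theorem mordellWeilRank_le : (E).mordellWeilRank ≤ 1 := by
  refine mordellWeilRank_le_of_linear_conditions hsplit (N := 9) (k := 6) (s := 1) rfl ψ κ hker kill κ_surjective ?_ ?_ ?_ ?_
  · rw [ψ_T1]; decide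
  · rw [ψ_T2]; decide
  · rw [map_add, ψ_T1, ψ_T2]; decide
  · rw [ψ_T1, ψ_T2]; decide

section Points

/-- The rational point `P1 = (-576, 35568)` of `E_1590`. [folklore] -/
def pt1 : (E).toAffine.Point :=
  .some (-576 : ℚ) (35568 : ℚ) ((cn_nonsingular_iff (n := 1590) (by norm_num) _ _).mpr (by norm_num))

/-- `ψ(P1)`. [folklore] -/
theorem ψ_pt1 : ψ pt1 = ![1, 1, 0, 0, 1, 0, 0, 0, 0] := by
  rw [pt1, ψ_some _ (by norm_num) (by norm_num)]
  ext i
  fin_cases i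
  · show parityBit 2 _ = 1
    exact parityBit_eq_of_eq 2 1 (u := 507) (v := 1) (1) (Or.inl rfl) (by norm_num) (by norm_num) (by norm_num)
  · show parityBit 3 _ = 1
    exact parityBit_eq_of_eq 3 1 (u := 338) (v := 1) (1) (Or.inl rfl) (by norm_num) (by norm_num) (by norm_num)
  · show parityBit 5 _ = 0
    exact parityBit_eq_of_eq 5 0 (u := 1014) (v := 1) (1) (Or.inl rfl) (by norm_num) (by norm_num) (by norm_num)
  · show parityBit 53 _ = 0
    exact parityBit_eq_of_eq 53 0 (u := 1014) (v := 1) (1) (Or.inl rfl) (by norm_num) (by norm_num) (by norm_num)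
  · show signBit _ = 1
    exact signBit_of_neg (by norm_num)
  · show parityBit 2 _ = 0
    exact parityBit_eq_of_eq 2 6 (u := 9) (v := 1) (-1) (Or.inr rfl) (by norm_num) (by norm_num) (by norm_num)
  · show parityBit 3 _ = 0
    exact parityBit_eq_of_eq 3 2 (u := 64) (v := 1) (-1) (Or.inr rfl) (by norm_num) (by norm_num) (by norm_num)
  · show parityBit 5 _ = 0
    exact parityBit_eq_of_eq 5 0 (u := 576) (v := 1) (-1) (Or.inr rfl) (by norm_num) (by norm_num) (by norm_num)
  · show parityBit 53 _ = 0
    exact parityBit_eq_of_eq 53 0 (u := 576) (v := 1) (-1) (Or.inr rfl) (by norm_num) (by norm_num) (by norm_num)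

end Points

/-- **`1 ≤ rk E_1590(ℚ)`**: the point(s) are independent of the `2`-torsion under `ψ`. [cite: SilvermanAEC2009, Prop. X.1.4] -/
theorem le_mordellWeilRank : 1 ≤ (E).mordellWeilRank := by
  refine le_mordellWeilRank_of_twoTorsion' hsplit ψ ![pt1] ?_ ?_
  · rw [ψ_T1, ψ_T2, ψ_T3]; decide
  · intro c ε₁ ε₂ hc
    simp only [Fin.sum_univ_succ, Fin.sum_univ_zero, Matrix.cons_val_zero, Matrix.cons_val_succ,
      ψ_pt1, ψ_T1, ψ_T2] at hc
    revert hc ε₁ ε₂ c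
    decide

/-- **`rk E_1590(ℚ) = 1`.** [cite: SilvermanAEC2009, Prop. X.1.4] -/
theorem mordellWeilRank_eq : (E).mordellWeilRank = 1 :=
  le_antisymm mordellWeilRank_le le_mordellWeilRank

end E1590

end Literature.Barriers.BirchSwinnertonDyer.CongruentDescent

end
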